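import Summits.CriticalPhenomena.Ising3DConformalLimit.Theses.FKParityRobustness
import Summits.CriticalPhenomena.Ising3DConformalLimit.Theorems.FKParityRobustnessDefs
import Literature.Probability.LatticeModels.LoopO1
import Literature.Probability.LatticeModels.RandomCluster
import Literature.Probability.LatticeModels.RandomClusterFKG
import Literature.Probability.LatticeModels.FKIsingRSWProofs
import Literature.Combinatorics.SimpleGraph.CycleSpaceSeparators
import HarnessLib

/-!
# The FK ← loop-O(1) transfer: stub `stub_fkLoopTransfer` of line `plaquette-xor-surgery`
# for crux `ParityRobustMerging` (stmt-CriticalPhenomena-11253)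

Route `FKParityRobustness`.  On a finite graph `G` with four distinct marked vertices
`a : Fin 4 → V`, `A = {aᵢ}`, at inverse temperature `β ≥ 0`, put `p = fkIsingParam β = 1 − e^{−2β}`,
`φ = rcMeasure G p 2 ∅` (free FK-Ising measure) and `t = tanh β = p / (2 − p)`.  GIVEN the sourced
Grimmett–Janson identity (the neighbouring stub `stub_grimmettJanson`, taken here as a hypothesis)

  `∑_{ω ⊆ E} w_{p,2}(ω) · #{F ∈ 𝒯_A(ω) : P F} / #𝓔_∅(ω)`
  `   = 2^{|V|} (1 − p/2)^{|E|} · ∑_{F ∈ 𝒯_A(G), P F} (p/(2−p))^{|F|}`,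

a loop-side bound `c · Z_t(A) ≤ Z_t(A; C)` (`zMass`, `C = JoinsAll a`) implies the crux's FK
inequality `c · φ[all aᵢ joined] ≤ ∫ u_a dφ` VERBATIM (`u_a(ω)` = fraction of the `T`-joins of `A`
inside `ω` keeping `A` in one component, with the crux's `Finset`-monad coercion in the numerator).

Proof (finite sums only):
* `tanh_eq_fkIsingParam_div` — `tanh β = p/(2 − p)`;
* `symmDiff_mem_tJoins` — `𝒯_A(ω) ∆ 𝒯_B(ω) ⊆ 𝒯_{A ∆ B}(ω)` (parities add mod 2,
  `even_edgeDeg_symmDiff_iff`), whence the SWITCHING COUNT `card_tJoins_eq_card_evenSubgraphs`: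
  `#𝒯_A(ω) = #𝓔_∅(ω)` as soon as `𝒯_A(ω) ≠ ∅` (`S ↦ S ∆ F₀` is an involution);
* `tJoins_nonempty_of_reachable` — if `a₀ ↔ a₁` and `a₂ ↔ a₃` in `(V, ω)` then `𝒯_A(ω) ≠ ∅`: the XOR
  of the edge sets of an `a₀a₁`-path and an `a₂a₃`-path (`odd_edgeDeg_walkEdges_iff`; this is where
  the injectivity of `a` is used, cf. `fkTransfer_false_without_injective`);
* `card_filter_bind_pure_coe` — the numerator of `u_a` through the `Finset` monad is
  `#{F ∈ sol ω : C F}`;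
* so `u_a(ω) = #{F ∈ 𝒯_A(ω) : C}/#𝓔_∅(ω)` and `1[J ω] ≤ #𝒯_A(ω)/#𝓔_∅(ω)`; with the identity at
  `P = C` and `P = ⊤`, `∫ u_a dφ = K · Z_t(A; C)` and `φ[J] ≤ K · Z_t(A)`,
  `K = 2^{|V|} (1 − p/2)^{|E|} / Z_RC ≥ 0` (`integral_rcMeasure`, `rcMeasure_real_apply`), and the
  conclusion follows for `c ≥ 0` by monotonicity and for `c < 0` from `∫ u_a dφ ≥ 0`.

Theorem-only file (no new definitions).  References: G. Grimmett, S. Janson, *Random even graphs*,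
Electron. J. Combin. 16 (2009), arXiv:0709.3039, Thm 3.1 [GrimmettJanson2007]; U. T. Hansen,
J. Jiang, F. R. Klausen, arXiv:2506.10765, §2 (switching principle
`|𝓔_A(ω)| = 1[ω ∈ 𝓕_A] |𝓔_∅(ω)|`) [HansenJiangKlausen2025].
-/

noncomputable section

open MeasureTheory Finset
open Literature.Probability.LatticeModels
open Literature.Combinatorics.SimpleGraph.CycleSpace

namespace Summit.CriticalPhenomena.Ising3DConformalLimit.Cruxes.ParityRobustMerging.PlaquetteXorSurgery

open scoped Classical

/-! ### `tanh β = p / (2 - p)` for `p = 1 - e^{-2β}` -/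

/-- The loop-O(1) weight of the FK-Ising coupling: `tanh β = p/(2 − p)` for `p = 1 − e^{−2β}`
(`= (1 − e^{−2β})/(1 + e^{−2β})`). [folklore] -/
theorem tanh_eq_fkIsingParam_div (β : ℝ) :
    Real.tanh β = fkIsingParam β / (2 - fkIsingParam β) := by
  have hxy : Real.exp β * Real.exp (-β) = 1 := by
    rw [← Real.exp_add, add_neg_cancel, Real.exp_zero]
  have he : Real.exp (-2 * β) = Real.exp (-β) * Real.exp (-β) := by
    rw [← Real.exp_add]; ring_nf
  have hcosh : Real.cosh β ≠ 0 := (Real.cosh_pos β).ne'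
  have hden : 2 - fkIsingParam β ≠ 0 := by
    have := Real.exp_pos (-2 * β)
    unfold fkIsingParam
    linarith
  rw [Real.tanh_eq_sinh_div_cosh, div_eq_div_iff hcosh hden, Real.sinh_eq, Real.cosh_eq,
    fkIsingParam, he]
  linear_combination Real.exp (-β) * hxy

/-- Propositional bookkeeping for `tJoins_nonempty_of_reachable`: the XOR of two parities with
disjoint odd sets. [folklore] -/
private theorem not_iff_iff_or_of_not_and {E₁ E₂ X Y : Prop} (o₁ : ¬E₁ ↔ X) (o₂ : ¬E₂ ↔ Y)
    (hXY : ¬(X ∧ Y)) : ¬(E₁ ↔ E₂) ↔ X ∨ Y := by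
  tauto

section General

variable {V : Type*} [Fintype V] [DecidableEq V] (G : SimpleGraph V) [DecidableRel G.Adj]

/-! ### `T`-joins: symmetric differences, the switching count, existence -/

/-- Parities add under symmetric difference: if `S` has odd set `A` and `T` has odd set `B` (inside
`ω ∩ E(G)`), then `S ∆ T` has odd set `A ∆ B`. [folklore] -/
theorem symmDiff_mem_tJoins {ω : Set (Sym2 V)} {A B : Finset V} {S T : Finset (Sym2 V)}
    (hS : S ∈ tJoins G ω A) (hT : T ∈ tJoins G ω B) :
    symmDiff S T ∈ tJoins G ω (symmDiff A B) := by
  rw [mem_tJoins] at hS hT ⊢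
  obtain ⟨hSG, hSω, hSpar⟩ := hS
  obtain ⟨hTG, hTω, hTpar⟩ := hT
  refine ⟨(symmDiff_le_sup (a := S) (b := T)).trans (Finset.union_subset hSG hTG), ?_, fun v => ?_⟩
  · intro e he
    rcases Finset.mem_symmDiff.1 (Finset.mem_coe.1 he) with ⟨h, -⟩ | ⟨h, -⟩
    · exact hSω (Finset.mem_coe.2 h)
    · exact hTω (Finset.mem_coe.2 h)
  · have key := even_edgeDeg_symmDiff_iff S T v
    simp only [edgeDeg] at key
    rw [Finset.mem_symmDiff, ← hSpar v, ← hTpar v, ← Nat.not_even_iff_odd, ← Nat.not_even_iff_odd,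
      ← Nat.not_even_iff_odd, key]
    tauto

/-- **Switching count.** If `𝒯_A(ω)` is non-empty then `#𝒯_A(ω) = #𝓔_∅(ω)`: for `F₀ ∈ 𝒯_A(ω)` the
involution `S ↦ S ∆ F₀` exchanges `𝓔_∅(ω)` and `𝒯_A(ω)` (HJK §2, `|𝓔_A(ω)| = 1[ω ∈ 𝓕_A] |𝓔_∅(ω)|`).
[cite: HansenJiangKlausen2025, §2] -/
theorem card_tJoins_eq_card_evenSubgraphs {ω : Set (Sym2 V)} {A : Finset V} {F₀ : Finset (Sym2 V)}
    (hF₀ : F₀ ∈ tJoins G ω A) : #(tJoins G ω A) = #(evenSubgraphs G ω) := by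
  refine Finset.card_nbij' (fun S => symmDiff S F₀) (fun S => symmDiff S F₀) ?_ ?_ ?_ ?_
  · intro S hS
    have h := symmDiff_mem_tJoins G (Finset.mem_coe.1 hS) hF₀
    rwa [symmDiff_self] at h
  · intro S hS
    have h := symmDiff_mem_tJoins G (Finset.mem_coe.1 hS) hF₀
    rwa [show symmDiff (∅ : Finset V) A = A from bot_symmDiff A] at h
  · intro S _
    exact symmDiff_symmDiff_cancel_right F₀ S
  · intro S _
    exact symmDiff_symmDiff_cancel_right F₀ S

/-- **Existence of a `T`-join from two pairing paths.** If `ω ⊆ E(G)`, the four marked vertices are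
distinct and `a₀ ↔ a₁`, `a₂ ↔ a₃` in `(V, ω)`, then the XOR of the edge sets of an `a₀a₁`-path and
an `a₂a₃`-path of `(V, ω)` is a `T`-join of `{aᵢ}` inside `ω`.  Injectivity of `a` is essential
(`fkTransfer_false_without_injective`). [folklore] -/
theorem tJoins_nonempty_of_reachable (ω : Finset (Sym2 V)) (hω : ω ⊆ G.edgeFinset) (a : Fin 4 → V)
    (ha : Function.Injective a)
    (h01 : (SimpleGraph.fromEdgeSet (↑ω : Set (Sym2 V))).Reachable (a 0) (a 1))
    (h23 : (SimpleGraph.fromEdgeSet (↑ω : Set (Sym2 V))).Reachable (a 2) (a 3)) :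
    (tJoins G (↑ω : Set (Sym2 V)) (univ.image a)).Nonempty := by
  obtain ⟨p⟩ := h01
  obtain ⟨q⟩ := h23
  have hsub : ∀ {u v : V} (r : (SimpleGraph.fromEdgeSet (↑ω : Set (Sym2 V))).Walk u v),
      ∀ e ∈ walkEdges r, e ∈ ω := by
    intro u v r e he
    have h := mem_edgeSet_of_mem_walkEdges r he
    rw [SimpleGraph.edgeSet_fromEdgeSet] at h
    exact Finset.mem_coe.1 h.1
  refine ⟨symmDiff (walkEdges p.toPath.1) (walkEdges q.toPath.1), ?_⟩
  rw [mem_tJoins]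
  refine ⟨?_, ?_, fun w => ?_⟩
  · intro e he
    rcases Finset.mem_symmDiff.1 he with ⟨h, -⟩ | ⟨h, -⟩
    · exact hω (hsub _ e h)
    · exact hω (hsub _ e h)
  · intro e he
    rcases Finset.mem_symmDiff.1 (Finset.mem_coe.1 he) with ⟨h, -⟩ | ⟨h, -⟩
    · exact Finset.mem_coe.2 (hsub _ e h)
    · exact Finset.mem_coe.2 (hsub _ e h)
  · have key := even_edgeDeg_symmDiff_iff (walkEdges p.toPath.1) (walkEdges q.toPath.1) w
    have o1 := odd_edgeDeg_walkEdges_iff p.toPath.2 (ha.ne (by decide : (0 : Fin 4) ≠ 1)) w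
    have o2 := odd_edgeDeg_walkEdges_iff q.toPath.2 (ha.ne (by decide : (2 : Fin 4) ≠ 3)) w
    have h02 := ha.ne (by decide : (0 : Fin 4) ≠ 2)
    have h03 := ha.ne (by decide : (0 : Fin 4) ≠ 3)
    have h12 := ha.ne (by decide : (1 : Fin 4) ≠ 2)
    have h13 := ha.ne (by decide : (1 : Fin 4) ≠ 3)
    have hmem : w ∈ univ.image a ↔ (w = a 0 ∨ w = a 1) ∨ (w = a 2 ∨ w = a 3) := by
      constructor
      · intro hw
        obtain ⟨i, -, rfl⟩ := Finset.mem_image.1 hw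
        fin_cases i <;> simp
      · rintro ((h | h) | (h | h)) <;> exact Finset.mem_image.2 ⟨_, Finset.mem_univ _, h.symm⟩
    have hXY : ¬((w = a 0 ∨ w = a 1) ∧ (w = a 2 ∨ w = a 3)) := by
      rintro ⟨h | h, h' | h'⟩
      · exact h02 (h.symm.trans h')
      · exact h03 (h.symm.trans h')
      · exact h12 (h.symm.trans h')
      · exact h13 (h.symm.trans h')
    show Odd (edgeDeg _ w) ↔ _
    rw [hmem, ← Nat.not_even_iff_odd, key]
    rw [← Nat.not_even_iff_odd] at o1 o2
    exact not_iff_iff_or_of_not_and o1 o2 hXY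

/-! ### The `Finset`-monad coercion of the crux's numerator -/

/-- The crux's numerator elaborates through Mathlib's classical `Finset` monad:
`filter P (s >>= fun F => pure ↑F) = (s.image (↑)).filter P`, which has the cardinality of
`s.filter (P ∘ (↑))` since `(↑) : Finset W → Set W` is injective. [folklore] -/
theorem card_filter_bind_pure_coe {W : Type*} (s : Finset (Finset W)) (P : Set W → Prop)
    [DecidablePred P] (Q : Finset W → Prop) [DecidablePred Q] (hPQ : ∀ F : Finset W, P ↑F ↔ Q F) :
    #(Finset.filter P (↑s : Finset (Set W))) = #(s.filter Q) := by
  have h1 : (↑s : Finset (Set W)) = s.image (fun F : Finset W => (↑F : Set W)) := by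
    show s.sup _ = _
    exact Finset.sup_singleton_apply s _
  have h2 : s.filter Q = s.filter (fun F : Finset W => P ↑F) :=
    Finset.filter_congr fun F _ => (hPQ F).symm
  rw [h1, Finset.filter_image, Finset.card_image_of_injective _ Finset.coe_injective, h2]

end General

/-! ### The registered stub -/

/-- Registered stub `stub_fkLoopTransfer` of the skeleton `Lines/plaquette-xor-surgery.lean` (crux
`ParityRobustMerging`, stmt-CriticalPhenomena-11253): `GrimmettJansonIdentity → FKTransfer`, i.e.
GIVEN the sourced Grimmett–Janson identity (antecedent, verbatim the neighbouring stub
`stub_grimmettJanson`'s conclusion), on every finite graph `G`, for `β ≥ 0`, `a` injective and every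
real `c`, the loop-side bound `c · Z_{tanh β}(A) ≤ Z_{tanh β}(A; C)` implies
`c · φ[all aᵢ joined] ≤ ∫ u_a dφ` for `φ = rcMeasure G (fkIsingParam β) 2 ∅` — the crux's inner
statement verbatim.  [cite: GrimmettJanson2007, Thm 3.1] -/
theorem stub_fkLoopTransfer :
    (∀ (V : Type) [Fintype V] [DecidableEq V] (G : SimpleGraph V) [DecidableRel G.Adj] (p : ℝ),
      p ∈ Set.Icc (0 : ℝ) 1 → ∀ (A : Finset V) (P : Finset (Sym2 V) → Prop),
        ∑ ω ∈ G.edgeFinset.powerset,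
            rcWeight G p 2 ∅ ω *
              ((#((tJoins G (↑ω : Set (Sym2 V)) A).filter (fun F => P F)) : ℝ) /
                (#(evenSubgraphs G (↑ω : Set (Sym2 V))) : ℝ)) =
          2 ^ Fintype.card V * (1 - p / 2) ^ #G.edgeFinset *
            ∑ F ∈ (tJoins G Set.univ A).filter (fun F => P F), (p / (2 - p)) ^ #F) →
    ∀ (V : Type) [Fintype V] [DecidableEq V] (G : SimpleGraph V) [DecidableRel G.Adj] (β : ℝ),
      0 ≤ β → ∀ a : Fin 4 → V, Function.Injective a → ∀ c : ℝ,
        c * zMass G (Real.tanh β) a (fun _ => True) ≤ zMass G (Real.tanh β) a (fun F => JoinsAll a F) →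
  (let φ := Literature.Probability.LatticeModels.rcMeasure G (Literature.Probability.LatticeModels.fkIsingParam β) 2 ∅; let sol : Set (Sym2 V) → Finset (Finset (Sym2 V)) := fun ω => G.edgeFinset.powerset.filter (fun F => (↑F : Set (Sym2 V)) ⊆ ω ∧ ∀ v, Odd (F.filter (fun e => v ∈ e)).card ↔ v ∈ Finset.univ.image a); let u : Set (Sym2 V) → ℝ := fun ω => (((sol ω).filter (fun F => ∀ i j, (SimpleGraph.fromEdgeSet (↑F : Set (Sym2 V))).Reachable (a i) (a j))).card : ℝ) / ((sol ω).card : ℝ); c * φ.real {ω | ∀ i j, (Literature.Probability.Percolation.openGraph ω).Reachable (a i) (a j)} ≤ ∫ ω, u ω ∂φ) := by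
  intro hGJ V _ _ G _ β hβ a ha c hc φ sol u
  -- parameters
  have hp : fkIsingParam β ∈ Set.Icc (0 : ℝ) 1 := fkIsingParam_mem_Icc hβ
  have h2 : (0 : ℝ) < 2 := two_pos
  have hZ := rcPartitionFunction_pos G hp h2 (∅ : Set V)
  have ht : Real.tanh β = fkIsingParam β / (2 - fkIsingParam β) := tanh_eq_fkIsingParam_div β
  have htanh : 0 ≤ Real.tanh β := by
    rw [ht]
    exact div_nonneg hp.1 (by linarith [hp.2])
  set K : ℝ := 2 ^ Fintype.card V * (1 - fkIsingParam β / 2) ^ #G.edgeFinset /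
    rcPartitionFunction G (fkIsingParam β) 2 ∅ with hK
  have hK0 : 0 ≤ K := by
    have : 0 ≤ 1 - fkIsingParam β / 2 := by linarith [hp.2]
    positivity
  -- `sol` is the tree's `tJoins`
  have hsol : ∀ ω, sol ω = tJoins G ω (univ.image a) := fun ω => rfl
  -- the value of `u`
  have hu : ∀ ω, u ω =
      (#((tJoins G ω (univ.image a)).filter fun F => JoinsAll a F) : ℝ) / #(evenSubgraphs G ω) := by
    intro ω
    simp only [u]
    rw [hsol ω, card_filter_bind_pure_coe _ _ (fun F => JoinsAll a F) ?_]
    · rcases (tJoins G ω (univ.image a)).eq_empty_or_nonempty with hemp | ⟨F₀, hF₀⟩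
      · rw [hemp]
        simp
      · rw [card_tJoins_eq_card_evenSubgraphs G hF₀]
    · intro F
      rfl
  -- (I) the integral of `u`
  have hI : ∫ ω, u ω ∂φ = K * zMass G (Real.tanh β) a (fun F => JoinsAll a F) := by
    have step1 : ∫ ω, u ω ∂φ = ∑ ω' ∈ G.edgeFinset.powerset,
        rcWeight G (fkIsingParam β) 2 ∅ ω' / rcPartitionFunction G (fkIsingParam β) 2 ∅ * u ↑ω' :=
      integral_rcMeasure G hp h2 ∅ u
    have step2 : ∀ ω' ∈ G.edgeFinset.powerset,
        rcWeight G (fkIsingParam β) 2 ∅ ω' / rcPartitionFunction G (fkIsingParam β) 2 ∅ * u ↑ω' =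
        rcWeight G (fkIsingParam β) 2 ∅ ω' *
          ((#((tJoins G (↑ω' : Set (Sym2 V)) (univ.image a)).filter fun F => JoinsAll a F) : ℝ) /
            (#(evenSubgraphs G (↑ω' : Set (Sym2 V))) : ℝ)) /
          rcPartitionFunction G (fkIsingParam β) 2 ∅ := by
      intro ω' _
      rw [hu]
      ring
    have step3 := hGJ V G (fkIsingParam β) hp (univ.image a) (fun F => JoinsAll a F)
    rw [step1, Finset.sum_congr rfl step2, ← Finset.sum_div, step3]
    unfold zMass
    rw [hK, ht]
    ring
  -- (II) the probability of `J`
  have hII :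
      φ.real {ω | ∀ i j, (Literature.Probability.Percolation.openGraph ω).Reachable (a i) (a j)} ≤
        K * zMass G (Real.tanh β) a (fun _ => True) := by
    have step1 := rcMeasure_real_apply G hp h2 (∅ : Set V)
      {ω : Literature.Probability.Percolation.BondConfig V |
        ∀ i j, (Literature.Probability.Percolation.openGraph ω).Reachable (a i) (a j)}
    have step3 := hGJ V G (fkIsingParam β) hp (univ.image a) (fun _ => True)
    simp only [Finset.filter_true] at step3
    refine step1.trans_le ((Finset.sum_le_sum (g := fun ω' : Finset (Sym2 V) =>
      rcWeight G (fkIsingParam β) 2 ∅ ω' *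
        ((#(tJoins G (↑ω' : Set (Sym2 V)) (univ.image a)) : ℝ) /
          (#(evenSubgraphs G (↑ω' : Set (Sym2 V))) : ℝ)) /
        rcPartitionFunction G (fkIsingParam β) 2 ∅) (fun ω' hω' => ?_)).trans_eq ?_)
    · have hnn : 0 ≤ rcWeight G (fkIsingParam β) 2 ∅ ω' *
          ((#(tJoins G (↑ω' : Set (Sym2 V)) (univ.image a)) : ℝ) /
            (#(evenSubgraphs G (↑ω' : Set (Sym2 V))) : ℝ)) /
          rcPartitionFunction G (fkIsingParam β) 2 ∅ :=
        div_nonneg (mul_nonneg (rcWeight_nonneg G hp h2.le ∅ ω') (by positivity)) hZ.le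
      split_ifs with hmem
      · have hmem' : ∀ i j, (SimpleGraph.fromEdgeSet (↑ω' : Set (Sym2 V))).Reachable (a i) (a j) :=
          hmem
        obtain ⟨F₀, hF₀⟩ := tJoins_nonempty_of_reachable G ω' (Finset.mem_powerset.1 hω') a ha
          (hmem' 0 1) (hmem' 2 3)
        have hE : (#(evenSubgraphs G (↑ω' : Set (Sym2 V))) : ℝ) ≠ 0 :=
          Nat.cast_ne_zero.2 (Finset.card_pos.2 ⟨∅, empty_mem_evenSubgraphs G _⟩).ne'
        rw [card_tJoins_eq_card_evenSubgraphs G hF₀, div_self hE, mul_one]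
      · exact hnn
    · rw [← Finset.sum_div, step3]
      unfold zMass
      rw [Finset.filter_true, hK, ht]
      ring
  -- conclusion
  rcases le_or_gt 0 c with hc0 | hc0
  · calc c * φ.real _ ≤ c * (K * zMass G (Real.tanh β) a (fun _ => True)) :=
          mul_le_mul_of_nonneg_left hII hc0
      _ = K * (c * zMass G (Real.tanh β) a (fun _ => True)) := by ring
      _ ≤ K * zMass G (Real.tanh β) a (fun F => JoinsAll a F) := mul_le_mul_of_nonneg_left hc hK0
      _ = ∫ ω, u ω ∂φ := hI.symm
  · calc c * φ.real _ ≤ 0 := mul_nonpos_of_nonpos_of_nonneg hc0.le measureReal_nonneg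
      _ ≤ K * zMass G (Real.tanh β) a (fun F => JoinsAll a F) :=
          mul_nonneg hK0 (zMass_nonneg G htanh a _)
      _ = ∫ ω, u ω ∂φ := hI.symm

end Summit.CriticalPhenomena.Ising3DConformalLimit.Cruxes.ParityRobustMerging.PlaquetteXorSurgery

end
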